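import Literature.NumberTheory.EllipticCurves.PerrinRiouCMSigma
import Literature.NumberTheory.EllipticCurves.FormalGroupLogSummableProofs
import Literature.NumberTheory.EllipticCurves.PadicSeriesEvaluation
import Literature.NumberTheory.EllipticCurves.PAdicHeightsLogProofs
import Literature.NumberTheory.LocalFields.PadicExpLogHomomorphisms
import Literature.RingTheory.FormalGroups.FunctionalEquationIntegrality
import HarnessLib

/-!
# Route `CyclotomicUntwist`, crux K1 `PSRankOneLowerHalfAtThree` (stmt-BirchSwinnertonDyer-21580):
# the σ-LINE FAMILY LAW, evaluation layer — the factor `exp(ε·log_V²)` of the shift law CONVERGES on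
# `p·(open unit disc)` with value `exp_p(ε·log_V(t)²)`, and `log_p` of it is `ε·log_V(t)²`

Cell `pub/bsd-wall` (D-0145 line `route-BirchSwinnertonDyer-CyclotomicUntwist`), seat `bsd-line-cycu-p1`
g4 (K1 base). THEOREMS ONLY (no definition, no named fact, no `sorry`); helper `--supports` K1 =
stmt-BirchSwinnertonDyer-21580. Sequel of `CyclotomicUntwistSigmaLineFamilyFormal.lean` (formal layer:
`formalSigma V c′ = formalSigma V c · exp(((c−c′)/2)·log_V²)`); feeds
`CyclotomicUntwistSigmaLineFamilyValues.lean` (height difference law and Perrin-Riou dichotomy). BSD is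
not proved by this file and nothing here is evidence for or against K1/K2.

The formal shift factor `E_ε = exp(ε·log_V²) ∈ ℚ_p⟦t⟧` is NOT `p`-integral (`1/n!`, `1/n`), so the
tree's evaluation calculus (`padicEval_mul/_subst`, integral series on the open unit disc) does not apply
to it directly. The way through is the DILATION `t = p·s`: `rescale p E_ε = F ∘ G` with
`F = exp(pX) = Σ pⁿXⁿ/n! ∈ ℤ_p⟦X⟧` (`v_p(n!) ≤ n`) and `G = (εp)·M²`, `M = p⁻¹·log_V(pX) ∈ ℤ_p⟦X⟧`
(`‖[tⁿ]log_V‖ ≤ ‖1/n‖`, `v_p(n) ≤ n−1`), both integral as soon as `‖ε‖ ≤ p`; then the tree's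
`padicEval_subst` and Robert's analysis of `exp_p`/`log_p` on the disc `|x| < r_p` finish.

* §1 `padicEval f (a·s) = padicEval (rescale a f) s` (termwise), `(c·f)(t) = c·f(t)`, absolute
  convergence of integral series on the open disc.
* §2 integrality of `M` and `F` (for `V/ℚ_p` with `p`-integral equation).
* §3 for `‖ε‖_p ≤ p`, `‖s‖ < 1`: **`(exp(ε log_V²))(p s) = exp_p(ε·log_V(p s)²)`**
  (`padicEval_exp_formalLog_sq`), **`log_p((exp(ε log_V²))(p s)) = ε·log_V(p s)²`**
  (`padicLog_padicEval_exp_formalLog_sq`, tree `padicLog` = Iwasawa's logarithm), the value is `≠ 0`,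
  its series converges absolutely; `log_V(p s) = p·M(s)` and `‖log_V(p s)‖ ≤ ‖p‖‖s‖`.

References: A. M. Robert, *A Course in p-adic Analysis* (GTM 198) Ch. V §4.1 (radius `r_p`, `exp(p)`),
§4.2 Prop. 1 (`|exp x − 1| = |x|`), Prop. 3 (`log exp = id`); J. H. Silverman, AEC IV.5.5, IV.6.3(a),
IV.6.4; B. Mazur, W. Stein, J. Tate, Doc. Math. Extra Vol. (2006) Thm. 1.3, §3.1 (the family of formal
solutions). [cite: Robert2000PadicAnalysis, Ch. V §4.2 Proposition 3] [cite: SilvermanAEC2009, Thm. IV.6.4]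
[cite: MazurSteinTate2006, Thm. 1.3]
-/

set_option autoImplicit false
set_option linter.dupNamespace false

noncomputable section

open scoped Classical Nat

open PowerSeries WeierstrassCurve Literature.NumberTheory.EllipticCurves Literature.RingTheory.FormalGroups
  Literature.NumberTheory.LocalFields Literature.NumberTheory.Transcendental

namespace Summit.BirchSwinnertonDyer.BirchSwinnertonDyer.Theorems.PSSigmaLineFamilyEvaluation

variable {p : ℕ} [Fact p.Prime]

/-! ### §1 Evaluation under the dilation `t = a·s` -/

/-- **Dilation**: `f(a·s) = (rescale a f)(s)` termwise (`[tⁿ] rescale a f = aⁿ[tⁿ]f`); no convergence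
needed (both sides are the same `tsum`). [folklore] -/
theorem padicEval_mul_eq_padicEval_rescale (f : ℚ_[p]⟦X⟧) (a s : ℚ_[p]) :
    padicEval f (a * s) = padicEval (rescale a f) s := by
  unfold padicEval
  refine tsum_congr fun n => ?_
  rw [coeff_rescale, mul_pow]
  ring

/-- The series of `f` at `a·s` is termwise the series of `rescale a f` at `s`. [folklore] -/
theorem term_rescale (f : ℚ_[p]⟦X⟧) (a s : ℚ_[p]) (n : ℕ) :
    coeff n f * (a * s) ^ n = coeff n (rescale a f) * s ^ n := by
  rw [coeff_rescale, mul_pow]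
  ring

/-- Summability at `a·s` is summability of the rescaled series at `s`. [folklore] -/
theorem summable_iff_summable_rescale (f : ℚ_[p]⟦X⟧) (a s : ℚ_[p]) :
    Summable (fun n : ℕ => coeff n f * (a * s) ^ n) ↔
      Summable (fun n : ℕ => coeff n (rescale a f) * s ^ n) := by
  have h : (fun n : ℕ => coeff n f * (a * s) ^ n) = fun n : ℕ => coeff n (rescale a f) * s ^ n :=
    funext fun n => term_rescale f a s n
  rw [h]

/-- `rescale a (C c) = C c`. [folklore] -/
theorem rescale_C' (a c : ℚ_[p]) : rescale a (C c) = C c := by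
  ext n
  rw [coeff_rescale, coeff_C]
  split_ifs with h
  · rw [h, pow_zero, one_mul]
  · rw [mul_zero]

/-- `rescale a` commutes with `exp`-substitution: `rescale a (exp(g)) = exp(rescale a g)` for `g(0) = 0`.
[folklore] -/
theorem rescale_exp_subst (a : ℚ_[p]) {g : ℚ_[p]⟦X⟧} (hg : constantCoeff g = 0) :
    rescale a ((exp ℚ_[p]).subst g) = (exp ℚ_[p]).subst (rescale a g) := by
  rw [rescale_eq_subst, rescale_eq_subst,
    subst_comp_subst_apply (HasSubst.of_constantCoeff_zero' hg) (HasSubst.smul_X' a)]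

/-- The series of an INTEGRAL power series converges absolutely on the open unit disc (comparison with
the geometric series). [folklore] -/
theorem summable_norm_padicEval_of_isPadicInt {f : ℚ_[p]⟦X⟧} (hf : IsPadicInt f) {s : ℚ_[p]}
    (hs : ‖s‖ < 1) : Summable fun n : ℕ => ‖coeff n f * s ^ n‖ := by
  refine Summable.of_nonneg_of_le (fun n => norm_nonneg _) (fun n => ?_)
    (summable_geometric_of_lt_one (norm_nonneg s) hs)
  rw [norm_mul, norm_pow]
  exact mul_le_of_le_one_left (pow_nonneg (norm_nonneg s) n) (isPadicInt_iff_coeff.mp hf n)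

/-- `(c·f)(t) = c·f(t)` (unconditionally, both sides being `tsum`s over a field). [folklore] -/
theorem padicEval_C_mul' (c : ℚ_[p]) (f : ℚ_[p]⟦X⟧) (t : ℚ_[p]) :
    padicEval (C c * f) t = c * padicEval f t := by
  unfold padicEval
  rw [← tsum_mul_left]
  refine tsum_congr fun n => ?_
  rw [coeff_C_mul, mul_assoc]

/-- `c·f ∈ ℤ_p⟦X⟧` for `‖c‖ ≤ 1`, `f ∈ ℤ_p⟦X⟧`. [folklore] -/
theorem isPadicInt_C_mul {c : ℚ_[p]} (hc : ‖c‖ ≤ 1) {f : ℚ_[p]⟦X⟧} (hf : IsPadicInt f) :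
    IsPadicInt (C c * f) := by
  rw [isPadicInt_iff_coeff] at hf ⊢
  intro n
  rw [coeff_C_mul, norm_mul]
  calc ‖c‖ * ‖coeff n f‖ ≤ 1 * 1 := mul_le_mul hc (hf n) (norm_nonneg _) zero_le_one
    _ = 1 := mul_one _

/-! ### §2 Integrality after dilation by `p` -/

/-- `n ≤ p^{n-1}` for `n ≥ 1` (real form). [folklore] -/
theorem natCast_le_prime_pow_sub_one {n : ℕ} (hn : 1 ≤ n) : (n : ℝ) ≤ (p : ℝ) ^ (n - 1) := by
  have hp : 2 ≤ p := (Fact.out : p.Prime).two_le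
  have h2 : n ≤ 2 ^ (n - 1) := by
    obtain ⟨m, rfl⟩ := Nat.exists_eq_add_of_le hn
    rw [Nat.add_sub_cancel_left]
    have := Nat.lt_two_pow_self (n := m)
    omega
  calc (n : ℝ) ≤ ((2 ^ (n - 1) : ℕ) : ℝ) := by exact_mod_cast h2
    _ ≤ ((p ^ (n - 1) : ℕ) : ℝ) := by exact_mod_cast Nat.pow_le_pow_left hp _
    _ = (p : ℝ) ^ (n - 1) := by push_cast; ring

/-- `‖p^{n-1}/n‖_p ≤ 1` for `n ≥ 1` (`v_p(n) ≤ n − 1`). [folklore] -/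
theorem norm_prime_pow_sub_one_mul_inv_natCast_le {n : ℕ} (hn : 1 ≤ n) :
    ‖(p : ℚ_[p]) ^ (n - 1) * ((n : ℚ_[p]))⁻¹‖ ≤ 1 := by
  have hp0 : (0 : ℝ) < p := by exact_mod_cast (Fact.out : p.Prime).pos
  rw [norm_mul, norm_pow, Padic.norm_p]
  have h1 := padic_norm_inv_natCast_le (p := p) n
  have h2 := natCast_le_prime_pow_sub_one (p := p) hn
  calc ((p : ℝ)⁻¹) ^ (n - 1) * ‖((n : ℚ_[p]))⁻¹‖ ≤ ((p : ℝ)⁻¹) ^ (n - 1) * (p : ℝ) ^ (n - 1) := by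
        gcongr; exact h1.trans h2
    _ = 1 := by rw [inv_pow, inv_mul_cancel₀ (pow_ne_zero _ hp0.ne')]

variable (V : WeierstrassCurve ℚ_[p]) [V.IsIntegral ℤ_[p]]

/-- **`‖[tⁿ] log_V‖ ≤ ‖1/n‖_p`** for a `p`-integral equation (`[tⁿ]log_V = c_{n−1}/n`, `c ∈ ℤ_p⟦t⟧` the
invariant differential, AEC IV.5.5). [Silverman AEC IV.5.5, IV.6.3(a)] [cite: SilvermanAEC2009, IV.5.5] -/
theorem norm_coeff_formalLog_le_norm_inv (n : ℕ) : ‖coeff n V.formalLog‖ ≤ ‖((n : ℚ_[p]))⁻¹‖ := by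
  rcases n with _ | _ | n
  · simp [formalLog, coeff_mk]
  · simp [formalLog, coeff_mk]
  · rw [formalLog, coeff_mk]
    dsimp only
    rw [norm_mul, map_div₀, map_one, one_div]
    have h1 : (algebraMap ℚ ℚ_[p] (n + 2 : ℚ)) = ((n + 2 : ℕ) : ℚ_[p]) := by
      rw [map_add, map_natCast, map_ofNat]; push_cast; ring
    have h2 : ‖coeff (n + 1) V.formalOmega‖ ≤ 1 := isPadicInt_iff_coeff.mp V.isPadicInt_formalOmega _
    rw [h1]
    calc _ ≤ ‖(((n + 2 : ℕ) : ℚ_[p]))⁻¹‖ * 1 := mul_le_mul_of_nonneg_left h2 (norm_nonneg _)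
      _ = _ := mul_one _

/-- **The dilated logarithm is divisible by `p` in `ℤ_p⟦s⟧`**: `M := p⁻¹·log_V(p·s)` has all coefficients
in `ℤ_p` (`[sⁿ]M = p^{n−1}·[tⁿ]log_V`, `‖p^{n−1}/n‖ ≤ 1`). [Silverman AEC IV.6.4] [cite: SilvermanAEC2009, IV.6.4] -/
theorem isPadicInt_dilatedLog :
    IsPadicInt (C ((p : ℚ_[p]))⁻¹ * rescale (p : ℚ_[p]) V.formalLog) := by
  rw [isPadicInt_iff_coeff]
  intro n
  rw [coeff_C_mul, coeff_rescale]
  rcases Nat.eq_zero_or_pos n with rfl | hn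
  · simp
  · have hp0 : (p : ℚ_[p]) ≠ 0 := by exact_mod_cast (Fact.out : p.Prime).ne_zero
    have hrw : ((p : ℚ_[p]))⁻¹ * ((p : ℚ_[p]) ^ n * coeff n V.formalLog) =
        (p : ℚ_[p]) ^ (n - 1) * coeff n V.formalLog := by
      obtain ⟨m, rfl⟩ := Nat.exists_eq_add_of_le hn
      rw [Nat.add_sub_cancel_left, pow_add, pow_one]
      field_simp
    rw [hrw, norm_mul]
    calc ‖(p : ℚ_[p]) ^ (n - 1)‖ * ‖coeff n V.formalLog‖
        ≤ ‖(p : ℚ_[p]) ^ (n - 1)‖ * ‖((n : ℚ_[p]))⁻¹‖ :=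
          mul_le_mul_of_nonneg_left (norm_coeff_formalLog_le_norm_inv V n) (norm_nonneg _)
      _ = ‖(p : ℚ_[p]) ^ (n - 1) * ((n : ℚ_[p]))⁻¹‖ := (norm_mul _ _).symm
      _ ≤ 1 := norm_prime_pow_sub_one_mul_inv_natCast_le hn

omit [V.IsIntegral ℤ_[p]] in
/-- The dilated logarithm has no constant term. [folklore] -/
theorem constantCoeff_dilatedLog :
    constantCoeff (C ((p : ℚ_[p]))⁻¹ * rescale (p : ℚ_[p]) V.formalLog) = 0 := by
  rw [map_mul, ← coeff_zero_eq_constantCoeff_apply (rescale _ _), coeff_rescale, pow_zero, one_mul,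
    coeff_zero_eq_constantCoeff_apply, constantCoeff_formalLog, mul_zero]

omit [V.IsIntegral ℤ_[p]] in
/-- `rescale p log_V = p · M`. [folklore] -/
theorem rescale_formalLog_eq :
    rescale (p : ℚ_[p]) V.formalLog = C (p : ℚ_[p]) * (C ((p : ℚ_[p]))⁻¹ * rescale (p : ℚ_[p]) V.formalLog) := by
  have hp0 : (p : ℚ_[p]) ≠ 0 := by exact_mod_cast (Fact.out : p.Prime).ne_zero
  rw [← mul_assoc, ← map_mul, mul_inv_cancel₀ hp0, map_one, one_mul]

/-- **`‖pⁿ/n!‖_p ≤ 1`** (`v_p(n!) ≤ n`, Legendre). [folklore] -/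
theorem norm_prime_pow_div_factorial_le (n : ℕ) : ‖(p : ℚ_[p]) ^ n / (n ! : ℚ_[p])‖ ≤ 1 := by
  have hp : p.Prime := Fact.out
  have hfac : (n ! : ℚ_[p]) ≠ 0 := by exact_mod_cast n.factorial_ne_zero
  have hv : padicValNat p n ! ≤ n := by
    have h := sub_one_mul_padicValNat_factorial (p := p) n
    have h1 : 1 ≤ p - 1 := Nat.le_sub_one_of_lt hp.one_lt
    have : padicValNat p n ! ≤ (p - 1) * padicValNat p n ! := Nat.le_mul_of_pos_left _ h1
    omega
  rw [norm_div, norm_pow, Padic.norm_p]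
  have hn : ‖(n ! : ℚ_[p])‖ = (p : ℝ) ^ (-(padicValNat p n ! : ℤ)) := by
    rw [show (n ! : ℚ_[p]) = ((n ! : ℕ) : ℚ_[p]) by norm_cast,
      Padic.norm_eq_zpow_neg_valuation (by exact_mod_cast n.factorial_ne_zero), Padic.valuation_natCast]
  rw [hn, div_le_one (zpow_pos (by exact_mod_cast hp.pos) _), inv_pow, ← zpow_natCast, ← zpow_neg]
  exact zpow_le_zpow_right₀ (by exact_mod_cast hp.one_le) (by omega)

/-- **`F := exp(p·X) = Σ pⁿXⁿ/n! ∈ ℤ_p⟦X⟧`**. [Robert 2000, Ch. V §4.1 Comment (2)] [folklore] -/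
theorem isPadicInt_rescale_exp : IsPadicInt (rescale (p : ℚ_[p]) (exp ℚ_[p])) := by
  rw [isPadicInt_iff_coeff]
  intro n
  rw [coeff_rescale, coeff_exp]
  have h : (p : ℚ_[p]) ^ n * algebraMap ℚ ℚ_[p] (1 / n !) = (p : ℚ_[p]) ^ n / (n ! : ℚ_[p]) := by
    rw [map_div₀, map_one, map_natCast]; ring
  rw [h]
  exact norm_prime_pow_div_factorial_le n


/-! ### §3 The exp factor evaluated: `exp(ε·log_V²)(t) = exp_p(ε·log_V(t)²)` on `t ∈ p·(open unit disc)` -/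

/-- `r_p`-bound: `‖p‖·‖u‖ < r_p` whenever `‖u‖ < 1` (for odd `p`: `1/p < r_p`; for `p = 2`: `r_2 = 1/2`).
[Robert 2000, Ch. V §4.1 Comments] [cite: Robert2000PadicAnalysis, Ch. V §4.1 Theorem] -/
theorem norm_prime_mul_lt_radius {u : ℚ_[p]} (hu : ‖u‖ < 1) :
    ‖(p : ℚ_[p]) * u‖ < (p : ℝ) ^ (-(1 : ℝ) / ((p : ℝ) - 1)) := by
  have hp : p.Prime := Fact.out
  have hp0 : (0 : ℝ) < p := by exact_mod_cast hp.pos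
  rw [norm_mul, Padic.norm_p]
  by_cases h2 : p = 2
  · subst h2
    rw [show ((2 : ℕ) : ℝ) = (2 : ℝ) by norm_num, rpow_radius_two]
    calc (2 : ℝ)⁻¹ * ‖u‖ < 2⁻¹ * 1 := by gcongr
      _ = 1 / 2 := by norm_num
  · calc (p : ℝ)⁻¹ * ‖u‖ ≤ (p : ℝ)⁻¹ * 1 := by gcongr
      _ = (p : ℝ)⁻¹ := mul_one _
      _ < _ := inv_lt_rpow_radius h2

/-- **`exp(p·X)` evaluated: `F(u) = exp_p(p·u)` for `‖u‖ < 1`** (`F = Σ pⁿXⁿ/n!`; Mathlib's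
`NormedSpace.exp` on the disc `‖x‖ < r_p`, `exp_eq_tsum_of_norm_lt_radius`).
[Robert 2000, Ch. V §4.1 Theorem] [cite: Robert2000PadicAnalysis, Ch. V §4.1 Theorem] -/
theorem padicEval_rescale_exp {u : ℚ_[p]} (hu : ‖u‖ < 1) :
    padicEval (rescale (p : ℚ_[p]) (exp ℚ_[p])) u = NormedSpace.exp ((p : ℚ_[p]) * u) := by
  rw [exp_eq_tsum_of_norm_lt_radius (p := p) (norm_prime_mul_lt_radius hu)]
  unfold padicEval
  refine tsum_congr fun n => ?_
  rw [coeff_rescale, coeff_exp, map_div₀, map_one, map_natCast, mul_pow]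
  ring

omit [V.IsIntegral ℤ_[p]] in
/-- The exp factor after dilation by `p`: `rescale p (exp(ε log_V²)) = F ∘ G` with `F = exp(pX)` and
`G = (ε p)·M²`, `M = p⁻¹ log_V(p s)`. [folklore] -/
theorem rescale_exp_formalLog_sq_eq (ε : ℚ_[p]) :
    rescale (p : ℚ_[p]) ((exp ℚ_[p]).subst (C ε * V.formalLog ^ 2)) =
      (rescale (p : ℚ_[p]) (exp ℚ_[p])).subst
        (C (ε * p) * (C ((p : ℚ_[p]))⁻¹ * rescale (p : ℚ_[p]) V.formalLog) ^ 2) := by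
  set M := C ((p : ℚ_[p]))⁻¹ * rescale (p : ℚ_[p]) V.formalLog with hM
  have hg0 : constantCoeff (C ε * V.formalLog ^ 2) = 0 := by
    rw [map_mul, map_pow, constantCoeff_formalLog, zero_pow two_ne_zero, mul_zero]
  have hM0 : constantCoeff M = 0 := constantCoeff_dilatedLog V
  have hG0 : constantCoeff (C (ε * p) * M ^ 2) = 0 := by
    rw [map_mul, map_pow, hM0, zero_pow two_ne_zero, mul_zero]
  rw [rescale_exp_subst _ hg0, map_mul, map_pow, rescale_C', rescale_formalLog_eq V, ← hM,
    rescale_eq_subst (p : ℚ_[p]) (exp ℚ_[p]),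
    subst_comp_subst_apply (HasSubst.smul_X' (p : ℚ_[p])) (HasSubst.of_constantCoeff_zero' hG0)]
  congr 1
  rw [subst_smul (HasSubst.of_constantCoeff_zero' hG0), subst_X (HasSubst.of_constantCoeff_zero' hG0),
    smul_eq_C_mul]
  simp only [map_mul]
  ring

omit [V.IsIntegral ℤ_[p]] in
/-- **`log_V(p·s) = p·M(s)`** with `M = p⁻¹·log_V(pX)`, for every `s` (termwise). [Silverman AEC IV.6.4]
[cite: SilvermanAEC2009, IV.6.4] -/
theorem padicEval_formalLog_prime_mul (s : ℚ_[p]) :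
    padicEval V.formalLog ((p : ℚ_[p]) * s) =
      (p : ℚ_[p]) * padicEval (C ((p : ℚ_[p]))⁻¹ * rescale (p : ℚ_[p]) V.formalLog) s := by
  rw [padicEval_mul_eq_padicEval_rescale]
  conv_lhs => rw [rescale_formalLog_eq V]
  rw [padicEval_C_mul']

/-- `‖log_V(p s)‖ ≤ ‖p‖·‖s‖ = ‖p s‖` for `‖s‖ < 1`. [Silverman AEC IV.6.4] [cite: SilvermanAEC2009, IV.6.4] -/
theorem norm_padicEval_formalLog_prime_mul_le {s : ℚ_[p]} (hs : ‖s‖ < 1) :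
    ‖padicEval V.formalLog ((p : ℚ_[p]) * s)‖ ≤ ‖(p : ℚ_[p])‖ * ‖s‖ := by
  rw [padicEval_formalLog_prime_mul V s, norm_mul]
  exact mul_le_mul_of_nonneg_left
    (norm_padicEval_le (isPadicInt_dilatedLog V) (constantCoeff_dilatedLog V) hs) (norm_nonneg _)

/-- The argument of the exponential is in the disc: `‖ε·log_V(ps)²‖ < r_p` for `‖ε‖ ≤ p`, `‖s‖ < 1`.
[Robert 2000, Ch. V §4.1] [cite: Robert2000PadicAnalysis, Ch. V §4.1 Theorem] -/
theorem norm_eps_mul_log_sq_lt_radius {ε : ℚ_[p]} (hε : ‖ε‖ ≤ p) {s : ℚ_[p]} (hs : ‖s‖ < 1) :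
    ‖ε * padicEval V.formalLog ((p : ℚ_[p]) * s) ^ 2‖ < (p : ℝ) ^ (-(1 : ℝ) / ((p : ℝ) - 1)) := by
  have hp : p.Prime := Fact.out
  have hp0 : (0 : ℝ) < p := by exact_mod_cast hp.pos
  set M := C ((p : ℚ_[p]))⁻¹ * rescale (p : ℚ_[p]) V.formalLog with hM
  have hMs : ‖padicEval M s‖ < 1 :=
    norm_padicEval_lt_one (isPadicInt_dilatedLog V) (constantCoeff_dilatedLog V) hs
  have hkey : ε * padicEval V.formalLog ((p : ℚ_[p]) * s) ^ 2 =
      (p : ℚ_[p]) * ((ε * p) * padicEval M s ^ 2) := by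
    rw [padicEval_formalLog_prime_mul V s, ← hM]; ring
  rw [hkey]
  refine norm_prime_mul_lt_radius ?_
  rw [norm_mul, norm_mul, norm_pow, Padic.norm_p]
  calc ‖ε‖ * (p : ℝ)⁻¹ * ‖padicEval M s‖ ^ 2 ≤ (p : ℝ) * (p : ℝ)⁻¹ * ‖padicEval M s‖ ^ 2 := by gcongr
    _ = ‖padicEval M s‖ ^ 2 := by rw [mul_inv_cancel₀ hp0.ne', one_mul]
    _ < 1 := by
      have h0 := norm_nonneg (padicEval M s)
      nlinarith

/-- **THE EXP FACTOR EVALUATED.** For a `p`-integral `V/ℚ_p`, `‖ε‖_p ≤ p` (`v_p(ε) ≥ −1`) and a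
parameter value `t = p·s`, `‖s‖ < 1` (i.e. `t ∈ p²ℤ_p`-ish: the point lies in `E₂`-level), the formal
factor `exp(ε·log_V²)` CONVERGES at `t` and its value is the genuine `p`-adic exponential
`exp_p(ε·log_V(t)²)` of `ε` times the square of the formal-group logarithm of the point:
`(exp(ε log_V²))(t) = exp_p(ε·log_V(t)²)`. Proof: dilate (`rescale p`), factor as `F ∘ G` with
`F = exp(pX) ∈ ℤ_p⟦X⟧` and `G = εp·M² ∈ ℤ_p⟦s⟧`, evaluate with the tree's `padicEval_subst`, and
identify `F(u) = exp_p(pu)`. [Robert 2000, Ch. V §4.1–4.2; Silverman AEC IV.6.4]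
[cite: Robert2000PadicAnalysis, Ch. V §4.2 Proposition 3] -/
theorem padicEval_exp_formalLog_sq {ε : ℚ_[p]} (hε : ‖ε‖ ≤ p) {s : ℚ_[p]} (hs : ‖s‖ < 1) :
    padicEval ((exp ℚ_[p]).subst (C ε * V.formalLog ^ 2)) ((p : ℚ_[p]) * s) =
      NormedSpace.exp (ε * padicEval V.formalLog ((p : ℚ_[p]) * s) ^ 2) := by
  have hp : p.Prime := Fact.out
  set M := C ((p : ℚ_[p]))⁻¹ * rescale (p : ℚ_[p]) V.formalLog with hM
  have hMint : IsPadicInt M := isPadicInt_dilatedLog V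
  have hM0 : constantCoeff M = 0 := constantCoeff_dilatedLog V
  have hεp : ‖ε * p‖ ≤ 1 := by
    rw [norm_mul, Padic.norm_p]
    have hp0 : (0 : ℝ) < p := by exact_mod_cast hp.pos
    calc ‖ε‖ * (p : ℝ)⁻¹ ≤ p * (p : ℝ)⁻¹ := by gcongr
      _ = 1 := mul_inv_cancel₀ hp0.ne'
  have hGint : IsPadicInt (C (ε * p) * M ^ 2) := isPadicInt_C_mul hεp (hMint.pow 2)
  have hG0 : constantCoeff (C (ε * p) * M ^ 2) = 0 := by
    rw [map_mul, map_pow, hM0, zero_pow two_ne_zero, mul_zero]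
  rw [padicEval_mul_eq_padicEval_rescale, rescale_exp_formalLog_sq_eq V ε, ← hM,
    padicEval_subst isPadicInt_rescale_exp hGint hG0 hs,
    padicEval_rescale_exp (norm_padicEval_lt_one hGint hG0 hs),
    padicEval_C_mul', padicEval_pow hMint hs, padicEval_formalLog_prime_mul V s, ← hM]
  congr 1
  ring

/-- **Its Iwasawa logarithm: `log_p((exp(ε log_V²))(t)) = ε·log_V(t)²`** (`t = p s`, `‖s‖ < 1`,
`‖ε‖ ≤ p`): the value is a principal unit in the disc `|1 − y| < r_p`, where `log_p ∘ exp_p = id`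
(Robert V.4.2 Prop. 3) and the tree's `padicLog` is the logarithmic series.
[Robert 2000, Ch. V §4.2 Proposition 3; Iwasawa 1972, §4.4] [cite: Robert2000PadicAnalysis, Ch. V §4.2 Proposition 3] -/
theorem padicLog_padicEval_exp_formalLog_sq {ε : ℚ_[p]} (hε : ‖ε‖ ≤ p) {s : ℚ_[p]} (hs : ‖s‖ < 1) :
    padicLog p (padicEval ((exp ℚ_[p]).subst (C ε * V.formalLog ^ 2)) ((p : ℚ_[p]) * s)) =
      ε * padicEval V.formalLog ((p : ℚ_[p]) * s) ^ 2 := by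
  have hx := norm_eps_mul_log_sq_lt_radius V hε hs
  rw [padicEval_exp_formalLog_sq V hε hs]
  have h1 : ‖1 - NormedSpace.exp (ε * padicEval V.formalLog ((p : ℚ_[p]) * s) ^ 2)‖ < 1 :=
    (norm_one_sub_exp_lt_radius (p := p) hx).trans (rpow_radius_lt_one p)
  rw [padicLog_eq_padicLogSeries h1]
  exact plog_exp_of_norm_lt_radius (p := p) hx

/-- The exp factor's value is non-zero. [cite: Robert2000PadicAnalysis, Ch. V §4.2 Proposition 1] -/
theorem padicEval_exp_formalLog_sq_ne_zero {ε : ℚ_[p]} (hε : ‖ε‖ ≤ p) {s : ℚ_[p]} (hs : ‖s‖ < 1) :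
    padicEval ((exp ℚ_[p]).subst (C ε * V.formalLog ^ 2)) ((p : ℚ_[p]) * s) ≠ 0 := by
  rw [padicEval_exp_formalLog_sq V hε hs]
  exact exp_ne_zero_of_norm_lt_radius (p := p) (norm_eps_mul_log_sq_lt_radius V hε hs)

/-- The exp factor's series converges absolutely at `t = p s`. [folklore] -/
theorem summable_norm_exp_formalLog_sq (ε : ℚ_[p]) {s : ℚ_[p]} (hs : ‖s‖ < 1) (hε : ‖ε‖ ≤ p) :
    Summable (fun n : ℕ => ‖coeff n ((exp ℚ_[p]).subst (C ε * V.formalLog ^ 2)) * ((p : ℚ_[p]) * s) ^ n‖) := by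
  have hp : p.Prime := Fact.out
  have hεp : ‖ε * p‖ ≤ 1 := by
    rw [norm_mul, Padic.norm_p]
    have hp0 : (0 : ℝ) < p := by exact_mod_cast hp.pos
    calc ‖ε‖ * (p : ℝ)⁻¹ ≤ p * (p : ℝ)⁻¹ := by gcongr
      _ = 1 := mul_inv_cancel₀ hp0.ne'
  have hGint : IsPadicInt (C (ε * p) * (C ((p : ℚ_[p]))⁻¹ * rescale (p : ℚ_[p]) V.formalLog) ^ 2) :=
    isPadicInt_C_mul hεp ((isPadicInt_dilatedLog V).pow 2)
  have hG0 : constantCoeff (C (ε * p) * (C ((p : ℚ_[p]))⁻¹ * rescale (p : ℚ_[p]) V.formalLog) ^ 2) = 0 := by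
    rw [map_mul, map_pow, constantCoeff_dilatedLog V, zero_pow two_ne_zero, mul_zero]
  have hfun : (fun n : ℕ => ‖coeff n ((exp ℚ_[p]).subst (C ε * V.formalLog ^ 2)) * ((p : ℚ_[p]) * s) ^ n‖) =
      fun n : ℕ => ‖coeff n (rescale (p : ℚ_[p]) ((exp ℚ_[p]).subst (C ε * V.formalLog ^ 2))) * s ^ n‖ :=
    funext fun n => by rw [term_rescale]
  rw [hfun, rescale_exp_formalLog_sq_eq V ε]
  exact summable_norm_padicEval_of_isPadicInt
    (isPadicInt_rescale_exp.powerSeries_subst hGint (HasSubst.of_constantCoeff_zero' hG0)) hs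


end Summit.BirchSwinnertonDyer.BirchSwinnertonDyer.Theorems.PSSigmaLineFamilyEvaluation

end
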